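import Summits.HodgeConjecture.HodgeConjecture.Theorems.NikulinTwinTransportSquareKunneth
import Literature.AlgebraicGeometry.HodgeTheory.GysinBaseChange
import Literature.AlgebraicGeometry.Surfaces.K3PeriodSurjectivityProofs

/-!
# Route NikulinTwinTransport · crux `HodgeSimilitudeAlgebraic` (stmt-HodgeConjecture-13676) —
# line `cm-norm-anchors`, stub `stub_kunnethComplexBetti`: Künneth spanning on the real carriers

Stub 3b of the skeleton `Cruxes.HodgeSimilitudeAlgebraic.CmNormAnchors` (lead reshape r2; registered
statement, verbatim): for `X`, `Z` smooth projective over `ℂ` of dimensions `l`, `n`, EVERY class of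
`Hᵏ((X ⊗ Z)(ℂ); ℂ)` is a `ℂ`-linear combination of cross products `fst^* a ∪ snd^* w`
(`a ∈ Hⁱ(X(ℂ); ℂ)`, `w ∈ Hʲ(Z(ℂ); ℂ)`, `i + j = k`) — the spanning half of the Künneth formula
(Hatcher, *Algebraic Topology*, Thm. 3.15/3.16) on the complex points of a product. It is the
"Künneth on real carriers" input of the line's anchor theorem `stub_cmSelfSimilitude_algebraic` (whose
proof builds the Künneth graph class of `η⁻¹ J η` from it) and, at the same time, the hypothesis
`hK` / `hKT` / `KunnethSpan` of the landed base-change reductions of `CompCorr`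
(`gysin_baseChange_of_kunneth`, `compCorr_of_kunneth`, `…SquareKunneth`, `…SquareGlueKunneth`).

## Mathematics and proof

The statement is, binder for binder, the tree's theorem
`Literature.AlgebraicGeometry.HodgeTheory.kunnethSpan_complexBetti` (file
`Literature/AlgebraicGeometry/HodgeTheory/GysinBaseChange`): the topological Künneth formula over a
field, `LerayHirsch.kunneth_mem_span_of_field` (base the compact `2l`-manifold `X(ℂ)`, fibre `Z(ℂ)`
with finite-dimensional cohomology vanishing above `2n`), transported along the homeomorphism
`(X ⊗ Z)(ℂ) ≃ₜ X(ℂ) × Z(ℂ)` of `AlgPoints.isHomeomorph_prodEquiv_holds` (Conrad, Prop. 2.1), whose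
components are `fst(ℂ)`, `snd(ℂ)`. The stub is that theorem, universally closed; it is NOT restated
under a new name here (use `kunnethSpan_complexBetti` directly in the explicit-hypothesis form).

This file also records, for the follow-up stub file of the anchor theorem (which imports this
module), the two UNCONDITIONAL consequences it consumes and the marked-lattice bookkeeping of the
square of a marked surface:

* `exists_fst_gysin_snd_ne_zero'`, `exists_fibreIntegral` — fibre integration
  `fst_*(snd^* w₁) = c • 1`, `c ≠ 0`, for a non-zero top class `w₁ ∈ H²ⁿ(Z(ℂ); ℂ)` (Fulton,
  *Young Tableaux*, App. B (4)–(5)): the route's `exists_fst_gysin_snd_ne_zero`,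
  `exists_fibreIntegral_of_kunneth` (`…SquareKunneth`) with their Künneth hypothesis `hKT` discharged
  by `kunnethSpan_complexBetti`.
* `k3Gram_mul_inv_cast`, `dualPair_marking` — under a marking `η : H²(S(ℂ); ℂ) ≃ Λ_ℂ`, the lattice
  basis `εⱼ = η⁻¹ eⱼ` and the integral dual basis `δⱼ = η⁻¹ (G⁻¹ eⱼ)` (`G` the K3 Gram matrix,
  `det G = -1`, so `G⁻¹` is integral) form a dual pair for the cup form `B(x, y) = (ηx . ηy)`:
  `x = Σⱼ B(x, δⱼ) εⱼ`, `y = Σⱼ B(εⱼ, y) δⱼ` (Huybrechts, *Lectures on K3 Surfaces*, Ch. 14 §0.3: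
  `Λ` is unimodular). Pure matrix algebra over `ℂ`.

No definitions, no named facts, nothing conditional.

## References

* [HatcherAT2002] A. Hatcher, Algebraic Topology, CUP 2002, §3.2 Thm. 3.15–3.16.
* [ConradAdelicPoints2012] B. Conrad, Weil and Grothendieck approaches to adelic points, Enseign.
  Math. 58 (2012), Prop. 2.1.
* [FultonYoungTableaux1997] W. Fulton, Young Tableaux, CUP 1997, Appendix B §B.1 (4)–(5).
* [Huybrechts2016K3] D. Huybrechts, Lectures on K3 Surfaces, CUP 2016, Ch. 14 §0.3.
-/

noncomputable section

open CategoryTheory MonoidalCategory CartesianMonoidalCategory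
open Literature.AlgebraicGeometry.Motives Literature.AlgebraicGeometry.HodgeTheory
open Literature.AlgebraicGeometry.Surfaces
open Literature.AlgebraicTopology.SingularHomology

namespace Summit.HodgeConjecture.HodgeConjecture.Theorems.NikulinTwinTransport.CmNormAnchors

/-! ### Fibre integration, unconditionally -/

section Kunneth

variable {l n : ℕ} {X Z : SchemeOver ℂ}

/-- **Fibre integration is non-trivial**: for `X`, `Z` smooth projective of dimensions `l`, `n`,
`fst_*(snd^* w) ≠ 0` in `H⁰(X(ℂ); ℂ)` for some top class `w ∈ H²ⁿ(Z(ℂ); ℂ)` — some top class of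
`(X ⊗ Z)(ℂ)` pairs non-trivially with `[X ⊗ Z]`, hence (Künneth, `kunnethSpan_complexBetti`) so does
some cross product `fst^* a ∪ snd^* w` of top-degree classes, and
`⟨fst^* a ∪ snd^* w, [X ⊗ Z]⟩ = ± ⟨a, fst_*(snd^* w) ⌢ [X]⟩`. The route's
`exists_fst_gysin_snd_ne_zero` (`…SquareKunneth`) with its Künneth hypothesis discharged.
[cite: FultonYoungTableaux1997, Appendix B §B.1 (5)] [cite: HatcherAT2002, §3.2 Thm. 3.15] -/
theorem exists_fst_gysin_snd_ne_zero' (μ : OrientationFamily)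
    (hX : IsSmoothProjective l X) (hZ : IsSmoothProjective n Z) :
    ∃ w : complexBetti Z (2 * n),
      complexGysin μ (IsSmoothProjective.tensor_holds hX hZ) hX (fst X Z)
        (show 2 * n + 2 * l = 0 + 2 * (l + n) by omega)
        (complexBetti.map (snd X Z) (2 * n) w) ≠ 0 :=
  exists_fst_gysin_snd_ne_zero μ hX hZ (kunnethSpan_complexBetti hX hZ _)

/-- **Fibre integration**: for `X`, `Z` smooth projective and a non-zero top class
`w₁ ∈ H²ⁿ(Z(ℂ); ℂ)`, `fst_*(snd^* w₁) = c • 1` in `H⁰(X(ℂ); ℂ)` with `c ≠ 0` (`H⁰(X(ℂ)) = ℂ · 1`,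
`H²ⁿ(Z(ℂ))` is a line, and `fst_* snd^*` does not vanish on it). Unconditional form of the route's
`exists_fibreIntegral_of_kunneth` (`…SquareKunneth`), the Künneth hypothesis being
`kunnethSpan_complexBetti`. [cite: FultonYoungTableaux1997, Appendix B §B.1 (4)–(5)] -/
theorem exists_fibreIntegral (μ : OrientationFamily)
    (hX : IsSmoothProjective l X) (hZ : IsSmoothProjective n Z)
    {w₁ : complexBetti Z (2 * n)} (hw₁ : w₁ ≠ 0) :
    ∃ c : ℂ, c ≠ 0 ∧
      complexGysin μ (IsSmoothProjective.tensor_holds hX hZ) hX (fst X Z)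
        (show 2 * n + 2 * l = 0 + 2 * (l + n) by omega)
        (complexBetti.map (snd X Z) (2 * n) w₁) = c • singularCohomology.one ℂ (ComplexPoints X) :=
  exists_fibreIntegral_of_kunneth μ hX hZ (kunnethSpan_complexBetti hX hZ _) hw₁

end Kunneth

/-! ### The square of a marked surface: the dual lattice basis -/

section MarkedSquare

variable {S : SchemeOver ℂ} (η : complexBetti S (2 * 1) ≃ₗ[ℂ] (K3Index → ℂ))

/-- The matrix identities `G · G⁻¹ = 1`, `G⁻¹ · G = 1` for the K3 Gram matrix `G` (`det G = -1`,
so the integral adjugate inverse is a two-sided inverse), read in `ℂ`. [folklore] -/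
theorem k3Gram_mul_inv_cast :
    (k3Gram.map (Int.cast : ℤ → ℂ)) * ((k3Gram⁻¹).map (Int.cast : ℤ → ℂ)) = 1 ∧
      ((k3Gram⁻¹).map (Int.cast : ℤ → ℂ)) * (k3Gram.map (Int.cast : ℤ → ℂ)) = 1 := by
  have hu : IsUnit k3Gram.det := by rw [k3Gram_det]; exact isUnit_one.neg
  have h1 := congrArg (fun M : Matrix K3Index K3Index ℤ => M.map (Int.castRingHom ℂ : ℤ → ℂ))
    (Matrix.mul_nonsing_inv k3Gram hu)
  have h2 := congrArg (fun M : Matrix K3Index K3Index ℤ => M.map (Int.castRingHom ℂ : ℤ → ℂ))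
    (Matrix.nonsing_inv_mul k3Gram hu)
  simp only [Matrix.map_mul, Matrix.map_one, map_zero, map_one] at h1 h2
  exact ⟨h1, h2⟩

/-- **The dual pair of lattice bases under a marking.** With `εⱼ = η⁻¹(eⱼ)` the marked standard
basis and `δⱼ = η⁻¹(G⁻¹ eⱼ)` (integral, `det G = -1`), every class expands as
`x = Σⱼ (ηx . ηδⱼ) εⱼ` and as `y = Σⱼ (ηεⱼ . ηy) δⱼ` (for the cup form `B(x,y) = (ηx.ηy)` read through
the marking). [cite: Huybrechts2016K3, Ch. 14 §0.3 (vi)] -/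
theorem dualPair_marking (B : LinearMap.BilinForm ℂ (complexBetti S (2 * 1)))
    (hB : ∀ x y, B x y = k3Form (η x) (η y)) (ε δ : K3Index → complexBetti S (2 * 1))
    (hε : ∀ j, ε j = η.symm (fun i => ((Pi.single j (1 : ℤ) : K3Index → ℤ) i : ℂ)))
    (hδ : ∀ j, δ j = η.symm (fun i => ((k3Gram⁻¹ i j : ℤ) : ℂ))) :
    (∀ x : complexBetti S (2 * 1), x = ∑ j, B x (δ j) • ε j) ∧
      (∀ y : complexBetti S (2 * 1), y = ∑ j, B (ε j) y • δ j) := by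
  classical
  obtain ⟨hGG, hG'G⟩ := k3Gram_mul_inv_cast
  have hsingle : ∀ j : K3Index, (fun i => ((Pi.single j (1 : ℤ) : K3Index → ℤ) i : ℂ)) =
      Pi.single j (1 : ℂ) := fun j => by
    funext i
    simp only [Pi.single_apply, Int.cast_ite, Int.cast_one, Int.cast_zero]
  -- `G (column j of G⁻¹) = eⱼ`
  have hcol : ∀ j : K3Index,
      Matrix.mulVec (k3Gram.map (Int.cast : ℤ → ℂ)) (fun i => ((k3Gram⁻¹ i j : ℤ) : ℂ)) =
        (Pi.single j (1 : ℂ) : K3Index → ℂ) := fun j => by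
    funext a
    have h := congrFun (congrFun hGG a) j
    rw [Matrix.mul_apply, Matrix.one_apply] at h
    simp only [Matrix.map_apply] at h
    simp only [Matrix.mulVec, dotProduct, Matrix.map_apply]
    rw [h, Pi.single_apply]
  refine ⟨fun x => ?_, fun y => ?_⟩
  · apply η.injective
    simp only [map_sum, map_smul, hε, hδ, hB, LinearEquiv.apply_symm_apply, k3Form_eq_dotProduct,
      hcol, dotProduct_single, mul_one, hsingle]
    funext i
    simp only [Finset.sum_apply, Pi.smul_apply, Pi.single_apply, smul_eq_mul, mul_ite, mul_one,
      mul_zero, Finset.sum_ite_eq, Finset.mem_univ, if_true]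
  · apply η.injective
    simp only [map_sum, map_smul, hε, hδ, hB, LinearEquiv.apply_symm_apply, k3Form_eq_dotProduct,
      hsingle, single_dotProduct, one_mul]
    funext b
    simp only [Finset.sum_apply, Pi.smul_apply, smul_eq_mul]
    have h := congrFun (congrArg (fun M : Matrix K3Index K3Index ℂ => Matrix.mulVec M (η y)) hG'G) b
    simp only [Matrix.one_mulVec, ← Matrix.mulVec_mulVec] at h
    rw [← h]
    simp only [Matrix.mulVec, dotProduct, Matrix.map_apply]
    refine Finset.sum_congr rfl fun j _ => ?_
    ring

end MarkedSquare

/-! ### The registered stub -/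

/-- **Stub 3b — `stub_kunnethComplexBetti`: the Künneth spanning property of `Hᵏ((X ⊗ Z)(ℂ); ℂ)`
on the real carriers** — every class on the complex points of a product of smooth projective
varieties is a `ℂ`-combination of cross products `fst^* a ∪ snd^* w` (Hatcher Thm. 3.15/3.16,
transported along `(X ⊗ Z)(ℂ) ≃ₜ X(ℂ) × Z(ℂ)`). The registered statement, verbatim; it is the
universal closure of `Literature.AlgebraicGeometry.HodgeTheory.kunnethSpan_complexBetti`.
[cite: HatcherAT2002, §3.2 Thm. 3.15 and Thm. 3.16] -/
theorem stub_kunnethComplexBetti :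
    (∀ (l n : ℕ) (X Z : SchemeOver ℂ), IsSmoothProjective l X → IsSmoothProjective n Z →
      ∀ (k : ℕ) (z : complexBetti (MonoidalCategoryStruct.tensorObj X Z) k),
        z ∈ Submodule.span ℂ
          {v | ∃ (i j : ℕ) (h : i + j = k) (a : complexBetti X i) (w : complexBetti Z j),
            v = cupProduct h (complexBetti.map (SemiCartesianMonoidalCategory.fst X Z) i a)
              (complexBetti.map (SemiCartesianMonoidalCategory.snd X Z) j w)}) :=
  fun _ _ _ _ hX hZ k z => kunnethSpan_complexBetti hX hZ k z

end Summit.HodgeConjecture.HodgeConjecture.Theorems.NikulinTwinTransport.CmNormAnchors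

end
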